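import Summits.Ventures.Crystal3D.Theorems.StickyWulffConstantCoaxialWallLawTailResidueModuleCapture
import HarnessLib

/-!
# Stub closer `stub_moduleCapture` of the registered skeleton 'CoaxialWallLawCertificates' v3 (crux `CoaxialWallLaw`, stmt-Ventures-19481)

HONEST FRAMING. Venture `Summits/Ventures/Crystal3D` (cell `crystal3d-full`); `--supports` the crux `CoaxialWallLaw` (stmt-Ventures-19481,
`route-Ventures-StickyWulffConstant`), registered line 'CoaxialWallLawCertificates' v3 (cf-p1, 2026-08-29T07:35:12Z; ten stubs, composition
`coaxialWallLaw_of_lensCertificates_mono_explicit`).  Closes the stub `stub_moduleCapture : TailResidue.ModuleCapture` BY NAME with the tree theorem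
`TailResidue.moduleCapture` (…TailResidueModuleCapture: the class collapse on the eight standard dozens `…ClassCollapse8.exists_stdFrame_adm_transfer`
+ the standard-reader lemma `…ReadingDirectionsLattice.stdFrame_of_exact_reader` + the position bookkeeping of `…TailResidueModuleCaptureShallow`).
Standard axioms.  Nothing new is proved here.
-/

namespace Summit.Ventures.Crystal3D.Cruxes.CoaxialWallLaw.Certificates

/-- **Stub closer**: `TailResidue.ModuleCapture` — every mono-module off-site payer window is captured (tree theorem `TailResidue.moduleCapture`). -/
theorem stub_moduleCapture : Summit.Ventures.Crystal3D.Theorems.TailResidue.ModuleCapture :=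
  Summit.Ventures.Crystal3D.Theorems.TailResidue.moduleCapture

end Summit.Ventures.Crystal3D.Cruxes.CoaxialWallLaw.Certificates
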